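import Literature.MathematicalPhysics.QuantumFieldTheory.Balaban1983to89.B8IdxB8SubDRigidity
import Literature.MathematicalPhysics.QuantumFieldTheory.Balaban1983to89.B8SockLettersRD
import Literature.MathematicalPhysics.QuantumFieldTheory.Balaban1983to89.B9SupplySockB9P3ZdLettersOmega

/-!
# `Balaban1983to89.B8SockLettersRDEmptyTowerInhabited` — [Balaban1985RegularSpaces] (1.3)–(1.6) p. 77 ∕ [Balaban1985BackgroundPropagators] Thm 3.1 p. 397 (the LETTERS as a
# hypothesis TEXT): THE [4]-TYPE LETTER PACKAGE `B8SockLettersRD.SockLettersRD` IS INHABITED AT THE (1.5)-OBEYING MEMBER WITH THE EMPTY TOWER `(η, k = 1, Ω = (ℤᵈ, ∅, ∅, …))`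
# — the POSITIVE twin of dag-n05-w1's `B8SockLettersRDIdxB8LawsBVacuity` (p613168) on the re-keyed index `Node00.IdxB8SubD θ`; a TEXT-CONSISTENCY certificate by a DEGENERATE witness

statement-level skeleton of published theorems with citation tags; proofs where landed; nothing here is a claim about the Yang–Mills mass gap

T. Bałaban, *Spaces of regular gauge field configurations on a lattice and gauge fixing conditions*, Commun. Math. Phys. **99** (1985) 75–102 `[Balaban1985RegularSpaces]`
("B8"; journal page = PDF page + 74): (1.3)–(1.6) p. 77, p. 77 «we admit the case where some domains Ω_j are equal to T_η», (1.91)–(1.92) p. 91, (1.95)–(1.98) p. 92, (1.101) p. 93.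
T. Bałaban, *Propagators for lattice gauge theories in a background field*, Commun. Math. Phys. **99** (1985) 389–434 `[Balaban1985BackgroundPropagators]` ("[4]"): Thm 3.1 p. 397,
(3.16) p. 393, (3.19) p. 393, (3.23)–(3.25) p. 394.

WHY (cell `pub-ymgap`, HUMAN RULING D-0062 ∕ D-0149; DAG node N05 = [B8]; width seat `pub-ymgap-dag-n05-w2` g4; proof lane, count-neutral).  The «P₂D» road of record
(dag-n05-d p619291) displays, among five (1.5)-keyed [4]-type families, the letter binders `SLet : ∀ i, Ω₀ = ℤᵈ → IdxB8LawsB → DomainSeq → (1.5) → SockLettersRD …` and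
`SLetUB`.  dag-n05-w1's p613168 showed the PRE-(1.5) binders UNSATISFIABLE (the all-`ℤᵈ` datum `i⋆`); the re-key removed `i⋆`, and referee ref-A registered
WATCH-P2D-SLET-INHABITATION (g28 ADDENDUM-1, g29 verdict on p619291): «positive inhabitation of `SLet` ∕ `SLetUB` at some `IdxB8SubD` member is NOT shown».  THIS FILE shows it at ONE
member — the simplest (1.5)-obeying one, `Ω = (ℤᵈ, ∅, ∅, …)`, `k = 1` (a member of `IdxB8SubD θ` by `B8IdxB8SubDRigidity.exists_idxB8SubD_of_domainSeq`, with `Λs 1 0 = ℤᵈ`,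
`Λs 1 1 = ∅` by rigidity) — for EVERY unitary background `U₀` and every `α₀` (no small-field input used), with explicit constants.

THE WITNESS (declared up front; it is DEGENERATE).  `Δ := Δ^η_{U₀}` (clause (3) forces it), `q := Pi.single 0` (level-`0` copy; `Q′₀ = id`, the level-`1` family is empty),
`qs := evaluation at level 0` (= `QT L 1 Λs U₀` here: `Q′₀ᵀ = id`, `Λs 1 1 = ∅`), `c := id`, `H′ X := X(0, ·)` (interpolation at level `0` is `Q′₀ = id`, level `1` is vacuous), and
`Aw := q ∘ (id − Δ) ∘ qs`, so that `Δ ∘ g + qs ∘ Aw ∘ q ∘ g = id` with **`g := id`**: the RD text constrains `Aw` through clause (1) ONLY, hence clause (1) is satisfiable identically;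
every bound clause then reduces to a sup bound `‖f‖ ≤ r ∕ η²` through n06's `norm_covDerivFwd_le` ∕ `norm_covLap_le`.

WHAT IT CERTIFIES ∕ WHAT NOT.  The TEXT of `SockLettersRD` (range form of W8″) and of p619291's inline `SLetUB` display is CONSISTENT at a (1.5)-member: no single-member contradiction
of the p613168 kind (interpolation clash) exists there.  It says NOTHING about [4] Thm 3.1's operators (the witness is not Bałaban's `G′`, `Q′ᵀaQ′`), NOTHING about joint
satisfiability over all members with uniform constants (= [4] Thm 3.1 on `ℤᵈ`, N06 content, OPEN), and it LOCATES for the socket-text owner (dag-n05-d), without proposing a repair: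
«`Aw` is free in the RD text — clause (1) alone constrains it».

WHAT IS PROVED (kernel, 0 sorry; theorems only).  §1 the member: `domainSeq_emptyTower`, ★ `exists_idxB8SubD_emptyTower` (`∃ j : IdxB8SubD θ`, `k = 1`, `η = L⁻¹`, `Ω = (ℤᵈ, ∅, …)`,
`Λs 1 0 = univ`, `Λs 1 1 = ∅`).  §2 ★★ `sockLettersRD_emptyTower` (generic `d`, `L ≥ 1`, `η > 0`, nontrivial C⋆ `𝔸`; data `Ω 0 = univ`, `Ω 1 = ∅`, `Λs 1 0 = univ`, `Λs 1 1 = ∅`;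
constants `BG = 2L∕η²`, `BR = 0`, `B₀′H = 2L`, `B₂′ = 4d`, any `cP`), ★ `sLetUB_text_emptyTower` (the inline uniqueness-side text, same data and constants).  §3 ★★
`exists_idxB8SubD_sockLettersRD` (`θ : Node00.Stage3Params`: `∃ j : IdxB8SubD θ, SockLettersRD θ.L (2L³) 0 (2L) (4D) cP j.η j.k j.Ω j.Λs`), ★ `exists_idxB8SubD_sLetUB_text`.

HONEST SCOPE.  A CONSISTENCY certificate for a hypothesis TEXT at ONE member by a degenerate witness; NO estimate; nothing of [B8] ∕ [4] asserted; the five (1.5)-keyed families of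
the N05 road remain HYPOTHESES (N06 content, `m ≥ 1` OPEN); count-neutral; N05 NOT discharged; K1⁸ `stmt-QuantumFields-26907` OPEN; no count claim (the chair's single count line is
the only count); `T_η ↦ ℤᵈ`; one finite `𝕋⁴` programme at fixed `ε`, Bałaban AS PRINTED; the Yang–Mills mass gap (Clay) is NOT proved by any of this — R4 closes the conditional
finite-`𝕋⁴` rung `BalabanLadder.UV` only; nothing continuum ∕ ℝ⁴ ∕ OS.  No `sorry` ∕ `def` ∕ `instance` ∕ `notation`.  `pub-ymgap-dag-n05-w2` (g4), 2026-08-28.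
RELATED, USED BY NAME, NOT DUPLICATED: `B8SockLettersRD` (dag-n05-d: the text), `B8SockLettersRDIdxB8LawsBVacuity` (dag-n05-w1: the negative twin), `B8IdxB8SubDRigidity` (this seat:
universality ∕ rigidity), `Node00/CarriersB8SubD` (dag-n05-w1: the index), `B9SupplySockB9P3ZdLettersOmega` (n06: `norm_covDerivFwd_le`, `norm_covLap_le`, `covLap_add`),
`B8Prop5JoinSectE.covLap_smul`.
[cite: Balaban1985RegularSpaces, (1.3)–(1.6) p.77, (1.91)–(1.92) p.91, (1.95)–(1.98) p.92, (1.101) p.93; Balaban1985BackgroundPropagators, Thm 3.1 p.397, (3.16) p.393, (3.23)–(3.25) p.394]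
-/

noncomputable section

open NormedSpace

namespace Literature.MathematicalPhysics.QuantumFieldTheory.Balaban1983to89.B8SockLettersRDEmptyTowerInhabited

open B7Prop1Explicit B7Prop1Local
open B7Prop2Explicit (unitaryUnits unitaryUnits_le_U1)
open B7Eq78Linearization (zdBlocking QprimeIter)
open B8Ineq132 (covDerivFwd InAk)
open B8Eq119TwistedAxial (bgT)
open B8Eq140Level (SideTouches)
open B8Eq138LandauZd (covLap QT QprimeT QprimeT_zero)
open B8Eq1117Concrete (XSpace)
open B8Prop5ContractionKLevel (Bd2)
open B8LambdaSpaceKLevel (wt)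
open B8LeafModelZd (ZdIdx)
open B8ConstraintBonds (DomainSeq Lam)
open B8SockLettersRD (SockLettersRD)
open B9SupplySockB9P3ZdLettersOmega (norm_covDerivFwd_le norm_covLap_le covLap_add)
open B8Prop5JoinSectE (covLap_smul)
open B8IdxB8SubDRigidity (exists_idxB8SubD_of_domainSeq mem_lamK_iff_of_lt mem_lamK_self_iff)
open B8Eq131DomainSeq (isLevel_pow_smul)
open Node00 (Stage3Params IdxB8SubD)

-- `Site` alone could resolve to the torus sites of `Setup.lean`; re-export the `ℤ^d` sites of `B7Prop1Explicit`.
export B7Prop1Explicit (Site)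

variable {d : ℕ}

/-! ## §1 The member: the empty tower `(ℤᵈ, ∅, ∅, …)` at depth `k = 1` -/

/-- **The empty tower obeys (1.3)–(1.4)** (`Ω₀ = ℤᵈ`, `Ω_j = ∅` for `j ≥ 1`; `anti` ∕ `sat` ∕ `sep` are trivial — print p. 77 admits `Ω_j = T_η`, and a sequence may end at once).
[cite: Balaban1985RegularSpaces, (1.3)–(1.4) p.77, p.77 («Ω_j = T_η»)] -/
theorem domainSeq_emptyTower (L : ℕ) : DomainSeq L (fun n : ℕ => if n = 0 then (Set.univ : Set (Site d)) else ∅) := by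
  refine ⟨fun n => ?_, fun n x y _ hx => ?_, fun n x t hx _ => ?_⟩
  · simp
  · rcases n with _ | n
    · simp
    · simp at hx
  · simp at hx

/-- ★ **THE EMPTY TOWER IS A (1.5)-OBEYING MEMBER OF THE INDEX OF RECORD**, spacing `L⁻¹`, depth `1`, with constraint families `Λs 1 0 = ℤᵈ` (= `Λ₀ = Ω₀^{(0)} ∖ Ω₁^{(0)}`) and
`Λs 1 1 = ∅` (= `Ω₁^{(1)}`) — by this seat's universality + rigidity (`B8IdxB8SubDRigidity`). [cite: Balaban1985RegularSpaces, (1.3)–(1.6) p.77, p.77 («Ω_j = T_η»)] -/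
theorem exists_idxB8SubD_emptyTower (θ : Stage3Params) :
    ∃ j : IdxB8SubD θ, j.1.1.1.1.k = 1 ∧ j.1.1.1.1.η = (θ.L : ℝ)⁻¹ ∧ (j.1.1.1.1.Ω = fun n => if n = 0 then Set.univ else ∅) ∧
      j.1.1.1.1.Λs 1 0 = Set.univ ∧ j.1.1.1.1.Λs 1 1 = ∅ := by
  have hL : 1 ≤ θ.L := le_trans (by norm_num) θ.two_le_L
  have hL0 : (0 : ℝ) < θ.L := by exact_mod_cast (show 0 < θ.L by omega)
  have hη : (0 : ℝ) < (θ.L : ℝ)⁻¹ := inv_pos.mpr hL0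
  have hscale : (θ.L : ℝ) ^ 1 * (θ.L : ℝ)⁻¹ ≤ 1 := by rw [pow_one, mul_inv_cancel₀ hL0.ne']
  obtain ⟨j, hjη, hjk, hjΩ, hΛ⟩ := exists_idxB8SubD_of_domainSeq θ hη le_rfl hscale (Ω := fun n => if n = 0 then Set.univ else ∅) (if_pos rfl)
    (domainSeq_emptyTower θ.L)
  refine ⟨j, hjk, hjη, hjΩ, ?_, ?_⟩
  · rw [hΛ]; ext y
    rw [mem_lamK_iff_of_lt θ.L _ zero_lt_one y]
    simp only [Set.mem_univ, iff_true]
    exact ⟨isLevel_pow_smul θ.L 0 y, by simp, by simp⟩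
  · rw [hΛ]; ext y
    rw [mem_lamK_self_iff θ.L _ 1 y]
    simp

/-! ## §2 The letters at the empty tower, for every unitary background — the degenerate witness -/

section Letters

variable {𝔸 : Type*} [CStarAlgebra 𝔸] [Nontrivial 𝔸]

/-- ★★ **`SockLettersRD` HOLDS AT THE EMPTY TOWER** (`Ω 0 = ℤᵈ`, `Ω 1 = ∅`, `Λs 1 0 = ℤᵈ`, `Λs 1 1 = ∅`, `k = 1`; `L ≥ 1`, `η > 0`; every unitary `U₀`, every `α₀`, any `cP`), with
`BG = 2L∕η²`, `BR = 0`, `B₀′H = 2L`, `B₂′ = 4d`.  Witness: `g = c = id`, `Δ = Δ^η_{U₀}`, `q = Pi.single 0`, `qs = eval₀`, `Aw = q ∘ (id − Δ) ∘ qs`, `H′X = X(0, ·)` — DEGENERATE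
(the text pins `Aw` through clause (1) only).  A consistency certificate for the TEXT; nothing of [4] Thm 3.1.
[cite: Balaban1985BackgroundPropagators, Thm 3.1 p.397, (3.16) p.393, (3.23)–(3.25) p.394; Balaban1985RegularSpaces, (1.91)–(1.92) p.91, (1.95)–(1.98) p.92, (1.101) p.93] -/
theorem sockLettersRD_emptyTower {L : ℕ} (hL : 1 ≤ L) {η : ℝ} (hη : 0 < η) {Ω : ℕ → Set (Site d)} {Λs : ℕ → ℕ → Set (Site d)}
    (hΩ0 : Ω 0 = Set.univ) (hΩ1 : Ω 1 = ∅) (hΛ0 : Λs 1 0 = Set.univ) (hΛ1 : Λs 1 1 = ∅) (cP : ℝ) :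
    SockLettersRD (𝔸 := 𝔸) L (2 * L * (η ^ 2)⁻¹) 0 (2 * L) (4 * d) cP η 1 Ω Λs := by
  intro α₀ _ _ U₀ hU₀ _ n hn1 hnk
  obtain rfl : n = 1 := le_antisymm hnk hn1
  have hU1 : ∀ x κ, U₀ x κ ∈ U1 𝔸 := fun x κ => unitaryUnits_le_U1 (hU₀ x κ)
  have hLr : (1 : ℝ) ≤ L := by exact_mod_cast hL
  have hη2 : 0 < η ^ 2 := by positivity
  -- the letters
  let Δ : (Site d → 𝔸) →ₗ[ℂ] (Site d → 𝔸) :=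
    { toFun := fun f x => covLap η U₀ f x
      map_add' := fun f g => funext fun x => covLap_add η U₀ f g x
      map_smul' := fun c f => funext fun x => by
        simp only [RingHom.id_apply, Pi.smul_apply]; exact covLap_smul η U₀ c f x }
  let q : (Site d → 𝔸) →ₗ[ℂ] (ℕ → Site d → 𝔸) := LinearMap.single ℂ (fun _ : ℕ => Site d → 𝔸) 0
  let qs : (ℕ → Site d → 𝔸) →ₗ[ℂ] (Site d → 𝔸) := LinearMap.proj 0
  let Aw : (ℕ → Site d → 𝔸) →ₗ[ℂ] (ℕ → Site d → 𝔸) := q ∘ₗ (LinearMap.id - Δ) ∘ₗ qs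
  let H' : XSpace d 1 𝔸 →ₗ[ℂ] (Site d → 𝔸) :=
    { toFun := fun X x => X ((0 : Fin 2), x)
      map_add' := fun X Y => funext fun x => by simp
      map_smul' := fun c X => funext fun x => by simp }
  have hΔ : ∀ f x, Δ f x = covLap η U₀ f x := fun _ _ => rfl
  have hq : ∀ f, q f = Pi.single (0 : ℕ) f := fun _ => rfl
  have hq0 : ∀ f, q f 0 = f := fun f => by rw [hq, Pi.single_eq_same]
  have hqs : ∀ μ, qs μ = μ 0 := fun _ => rfl
  have hqsq : ∀ f, qs (q f) = f := fun f => by rw [hqs, hq0]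
  have hH : ∀ (X : XSpace d 1 𝔸) x, H' X x = X (0, x) := fun _ _ => rfl
  have hHn : ∀ (X : XSpace d 1 𝔸) x, ‖H' X x‖ ≤ ‖X‖ := fun X x => by rw [hH]; exact X.norm_coe_le_norm (0, x)
  -- the sup bounds behind every bound clause
  have hwt : ∀ j, j ≤ 1 → wt L η j ≤ L * η := by
    intro j hj
    rcases Nat.le_one_iff_eq_zero_or_eq_one.1 hj with rfl | rfl
    · simp only [wt, pow_zero, one_mul]; exact le_mul_of_one_le_left hη.le hLr
    · simp [wt]
  have hder : ∀ (f : Site d → 𝔸) (s : ℝ), (∀ y, ‖f y‖ ≤ s) → ∀ j, j ≤ 1 → ∀ (x : Site d) (κ : Fin d),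
      wt L η j * ‖covDerivFwd η U₀ κ f x‖ ≤ 2 * L * s := by
    intro f s hs j hj x κ
    have h1 : ‖covDerivFwd η U₀ κ f x‖ ≤ η⁻¹ * (2 * s) :=
      (norm_covDerivFwd_le hη (hU1 x κ) f).trans (mul_le_mul_of_nonneg_left (by linarith [hs (x + e κ), hs x]) (inv_nonneg.mpr hη.le))
    have hs0 : 0 ≤ s := (norm_nonneg _).trans (hs x)
    calc wt L η j * ‖covDerivFwd η U₀ κ f x‖ ≤ (L * η) * (η⁻¹ * (2 * s)) :=
          mul_le_mul (hwt j hj) h1 (norm_nonneg _) (by positivity)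
      _ = 2 * L * s := by field_simp
  have hlap : ∀ (f : Site d → 𝔸) (s : ℝ), (∀ y, ‖f y‖ ≤ s) → ∀ x : Site d, wt L η 0 ^ 2 * ‖covLap η U₀ f x‖ ≤ 4 * d * s := by
    intro f s hs x
    have h := norm_covLap_le hη hU1 hs x
    have hs0 : 0 ≤ s := (norm_nonneg _).trans (hs x)
    simp only [wt, pow_zero, one_mul]
    calc η ^ 2 * ‖covLap η U₀ f x‖ ≤ η ^ 2 * (4 * d * (η⁻¹ * (η⁻¹ * s))) := mul_le_mul_of_nonneg_left h hη2.le
      _ = 4 * d * s := by field_simp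
  -- a `Bd2`-bounded function at this member is globally bounded by `r ∕ η²`
  have hBd : ∀ (f : Site d → 𝔸) (r : ℝ), Bd2 L η 1 Ω f r → ∀ y, ‖f y‖ ≤ (η ^ 2)⁻¹ * r := by
    intro f r hf y
    have h := hf 0 (Nat.zero_le 1) y (by rw [hΩ0]; exact Set.mem_univ y)
    simp only [wt, pow_zero, one_mul] at h
    rw [inv_mul_eq_div, le_div_iff₀ hη2]; linarith
  refine ⟨LinearMap.id, Δ, q, qs, Aw, LinearMap.id, H', ?_, ?_, ?_, ?_, ?_, ?_, ?_, ?_, ?_, ?_, ?_, ?_, ?_, ?_, ?_, ?_⟩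
  · -- (1) `Δ g + qs Aw q g = id` with `g = id`: `Aw` absorbs `−Δ`
    intro x y _
    simp only [LinearMap.id_apply, Aw, LinearMap.comp_apply, hqsq, LinearMap.sub_apply, LinearMap.id_apply, Pi.add_apply, Pi.sub_apply]
    abel
  · -- (2) the law of `c` on the range of `q`
    intro f
    simp only [LinearMap.id_apply, hqsq]
  · -- (3) `Δ` is the covariant Laplacian on `Ω₀ = ℤᵈ`
    intro f x _
    rw [hΔ, hΩ0, Set.indicator_univ]
  · -- (4) `qs = Q′ᵀ` at the tower: `Q′₀ᵀ = id` on `Λs 1 0 = ℤᵈ`, the level-`1` family is empty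
    intro μ x _
    have h0 : QprimeT L U₀ 1 ((Λs 1 1).indicator (μ 1)) x = 0 := by
      rw [hΛ1, Set.indicator_empty]; exact QprimeT_zero L U₀ 1 x
    rw [hqs, QT, Finset.sum_range_succ, Finset.sum_range_succ, Finset.sum_range_zero, zero_add, h0, add_zero, hΛ0, Set.indicator_univ]
    rfl
  · -- (5) `q = Q′` at the tower sites
    intro f j hj y hy
    rcases Nat.le_one_iff_eq_zero_or_eq_one.1 hj with rfl | rfl
    · rw [hq0]; rfl
    · rw [hΛ1] at hy; exact absurd hy (Set.notMem_empty y)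
  · -- (6) `‖H′X‖ ≤ B₀′H‖X‖`
    intro X x
    exact (hHn X x).trans (le_mul_of_one_le_left (norm_nonneg X) (by linarith))
  · -- (7) weighted covariant derivatives of `H′X`
    intro j hj X p _
    exact hder (H' X) ‖X‖ (hHn X) j hj p.1 p.2
  · -- (8) `Bd2` of the Laplacian of `H′X`
    intro X j hj x hx
    rcases Nat.le_one_iff_eq_zero_or_eq_one.1 hj with rfl | rfl
    · exact hlap (H' X) ‖X‖ (hHn X) x
    · rw [hΩ1] at hx; exact absurd hx (Set.notMem_empty x)
  · -- (9) `H′X = 0` off `Ω₀ = ℤᵈ` (vacuous)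
    intro X x hx
    rw [hΩ0] at hx; exact absurd (Set.mem_univ x) hx
  · -- (10) reality of `H′`
    intro X Y hXY x
    rw [hH, hH, hXY]
  · -- (11) interpolation: `Q′₀(H′Y) = Y(0, ·)`, level `1` vacuous
    intro Y j hj y hy
    rcases Nat.le_one_iff_eq_zero_or_eq_one.1 hj with rfl | rfl
    · rfl
    · rw [hΛ1] at hy; exact absurd hy (Set.notMem_empty y)
  · -- (12) bounds of `g = id` under `Bd2`
    intro f r hr hf
    have hb := hBd f r hf
    have hrη : (η ^ 2)⁻¹ * r ≤ 2 * L * (η ^ 2)⁻¹ * r := by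
      have : 0 ≤ (η ^ 2)⁻¹ * r := by positivity
      nlinarith
    refine ⟨fun x => (hb x).trans (by simpa using hrη), fun j hj p _ => ?_⟩
    calc wt L η j * ‖covDerivFwd η U₀ p.2 (LinearMap.id f) p.1‖ ≤ 2 * L * ((η ^ 2)⁻¹ * r) := hder f _ hb j hj p.1 p.2
      _ = 2 * L * (η ^ 2)⁻¹ * r := by ring
  · -- (13) `g f = 0` off `Ω₀` (vacuous)
    intro f x hx
    rw [hΩ0] at hx; exact absurd (Set.mem_univ x) hx
  · -- (14) reality of `g = id`
    intro f hf x
    exact hf 0 (Nat.zero_le 1) x (by rw [hΩ0]; exact Set.mem_univ x)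
  · -- (15) the residual `f − g qs c q g f = 0`
    intro f r _ _ j _ x _
    simp only [LinearMap.id_apply, hqsq, sub_self, Pi.zero_apply, norm_zero, mul_zero, zero_mul, le_refl]
  · -- (16) reality of the residual (it is `0`)
    intro f _ j _ x _
    simp only [LinearMap.id_apply, hqsq, sub_self, Pi.zero_apply]
    exact IsSelfAdjoint.zero _

/-- ★ **THE INLINE UNIQUENESS-SIDE TEXT (`SLetUB` of p619291) HOLDS AT THE EMPTY TOWER**, same data, same constants, same degenerate witness (bounded left inverse ∕ `qs c q g g qs = qs` ∕
«`q = 0` off the tower» editions of the clauses). [cite: Balaban1985BackgroundPropagators, Thm 3.1 p.397, (3.16) p.393, (3.23)–(3.25) p.394; Balaban1985RegularSpaces, (1.107)–(1.109) p.94] -/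
theorem sLetUB_text_emptyTower {L : ℕ} (hL : 1 ≤ L) {η : ℝ} (hη : 0 < η) {Ω : ℕ → Set (Site d)} {Λs : ℕ → ℕ → Set (Site d)}
    (hΩ0 : Ω 0 = Set.univ) (hΩ1 : Ω 1 = ∅) (hΛ0 : Λs 1 0 = Set.univ) (hΛ1 : Λs 1 1 = ∅) (cL : ℝ) :
    ∀ α₀ : ℝ, 0 < α₀ → α₀ ≤ cL → ∀ U₀ : Site d → Fin d → 𝔸ˣ, (∀ x κ, U₀ x κ ∈ unitaryUnits 𝔸) → InAk L 1 η α₀ Ω U₀ →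
      ∃ (g Δ : (Site d → 𝔸) →ₗ[ℂ] (Site d → 𝔸)) (q : (Site d → 𝔸) →ₗ[ℂ] (ℕ → Site d → 𝔸))
        (qs : (ℕ → Site d → 𝔸) →ₗ[ℂ] (Site d → 𝔸)) (Aw c : (ℕ → Site d → 𝔸) →ₗ[ℂ] (ℕ → Site d → 𝔸))
        (H' : XSpace d 1 𝔸 →ₗ[ℂ] (Site d → 𝔸)),
        (∀ x : Site d → 𝔸, (∃ C : ℝ, ∀ y, ‖x y‖ ≤ C) → g (Δ x + qs (Aw (q x))) = x) ∧ (∀ φ, qs (c (q (g (g (qs φ))))) = qs φ) ∧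
        (∀ (f : Site d → 𝔸), ∀ x ∈ Ω 0, Δ f x = covLap η U₀ ((Ω 0).indicator f) x) ∧
        (∀ (μ : ℕ → Site d → 𝔸), ∀ x ∈ Ω 0, qs μ x = QT L 1 (Λs 1) U₀ μ x) ∧
        (∀ (f : Site d → 𝔸) (n : ℕ), n ≤ 1 → ∀ y ∈ Λs 1 n, q f n y = QprimeIter (zdBlocking d L) (bgT L U₀) n f y) ∧
        (∀ (f : Site d → 𝔸) (n : ℕ) (y : Site d), ¬ (n ≤ 1 ∧ y ∈ Λs 1 n) → q f n y = 0) ∧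
        (∀ (X : XSpace d 1 𝔸) (x : Site d), ‖H' X x‖ ≤ (2 * L) * ‖X‖) ∧
        (∀ n, n ≤ 1 → ∀ (X : XSpace d 1 𝔸), ∀ p ∈ {b : Site d × Fin d | SideTouches (Ω n) b.1 b.2},
          wt L η n * ‖covDerivFwd η U₀ p.2 (H' X) p.1‖ ≤ (2 * L) * ‖X‖) ∧
        (∀ X : XSpace d 1 𝔸, Bd2 L η 1 Ω (covLap η U₀ (H' X)) ((4 * d) * ‖X‖)) ∧
        (∀ (Y : XSpace d 1 𝔸) (n : ℕ) (hn : n ≤ 1) (y : Site d), y ∈ Λs 1 n →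
          QprimeIter (zdBlocking d L) (bgT L U₀) n (H' Y) y = Y (⟨n, Nat.lt_succ_of_le hn⟩, y)) ∧
        (∀ (f : Site d → 𝔸) (r : ℝ), 0 ≤ r → Bd2 L η 1 Ω f r →
          (∀ x, ‖g f x‖ ≤ (2 * L * (η ^ 2)⁻¹) * r) ∧ ∀ n, n ≤ 1 → ∀ p ∈ {b : Site d × Fin d | SideTouches (Ω n) b.1 b.2},
            wt L η n * ‖covDerivFwd η U₀ p.2 (g f) p.1‖ ≤ (2 * L * (η ^ 2)⁻¹) * r) ∧
        (∀ (f : Site d → 𝔸) (r : ℝ), 0 ≤ r → Bd2 L η 1 Ω f r → Bd2 L η 1 Ω (f - g (qs (c (q (g f))))) (0 * r)) := by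
  intro α₀ _ _ U₀ hU₀ _
  have hU1 : ∀ x κ, U₀ x κ ∈ U1 𝔸 := fun x κ => unitaryUnits_le_U1 (hU₀ x κ)
  have hLr : (1 : ℝ) ≤ L := by exact_mod_cast hL
  have hη2 : 0 < η ^ 2 := by positivity
  let Δ : (Site d → 𝔸) →ₗ[ℂ] (Site d → 𝔸) :=
    { toFun := fun f x => covLap η U₀ f x
      map_add' := fun f g => funext fun x => covLap_add η U₀ f g x
      map_smul' := fun c f => funext fun x => by
        simp only [RingHom.id_apply, Pi.smul_apply]; exact covLap_smul η U₀ c f x }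
  let q : (Site d → 𝔸) →ₗ[ℂ] (ℕ → Site d → 𝔸) := LinearMap.single ℂ (fun _ : ℕ => Site d → 𝔸) 0
  let qs : (ℕ → Site d → 𝔸) →ₗ[ℂ] (Site d → 𝔸) := LinearMap.proj 0
  let Aw : (ℕ → Site d → 𝔸) →ₗ[ℂ] (ℕ → Site d → 𝔸) := q ∘ₗ (LinearMap.id - Δ) ∘ₗ qs
  let H' : XSpace d 1 𝔸 →ₗ[ℂ] (Site d → 𝔸) :=
    { toFun := fun X x => X ((0 : Fin 2), x)
      map_add' := fun X Y => funext fun x => by simp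
      map_smul' := fun c X => funext fun x => by simp }
  have hΔ : ∀ f x, Δ f x = covLap η U₀ f x := fun _ _ => rfl
  have hq : ∀ f, q f = Pi.single (0 : ℕ) f := fun _ => rfl
  have hq0 : ∀ f, q f 0 = f := fun f => by rw [hq, Pi.single_eq_same]
  have hqne : ∀ f n, n ≠ 0 → q f n = 0 := fun f n hn => by rw [hq, Pi.single_eq_of_ne hn]
  have hqs : ∀ μ, qs μ = μ 0 := fun _ => rfl
  have hqsq : ∀ f, qs (q f) = f := fun f => by rw [hqs, hq0]
  have hH : ∀ (X : XSpace d 1 𝔸) x, H' X x = X (0, x) := fun _ _ => rfl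
  have hHn : ∀ (X : XSpace d 1 𝔸) x, ‖H' X x‖ ≤ ‖X‖ := fun X x => by rw [hH]; exact X.norm_coe_le_norm (0, x)
  have hwt : ∀ j, j ≤ 1 → wt L η j ≤ L * η := by
    intro j hj
    rcases Nat.le_one_iff_eq_zero_or_eq_one.1 hj with rfl | rfl
    · simp only [wt, pow_zero, one_mul]; exact le_mul_of_one_le_left hη.le hLr
    · simp [wt]
  have hder : ∀ (f : Site d → 𝔸) (s : ℝ), (∀ y, ‖f y‖ ≤ s) → ∀ j, j ≤ 1 → ∀ (x : Site d) (κ : Fin d),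
      wt L η j * ‖covDerivFwd η U₀ κ f x‖ ≤ 2 * L * s := by
    intro f s hs j hj x κ
    have h1 : ‖covDerivFwd η U₀ κ f x‖ ≤ η⁻¹ * (2 * s) :=
      (norm_covDerivFwd_le hη (hU1 x κ) f).trans (mul_le_mul_of_nonneg_left (by linarith [hs (x + e κ), hs x]) (inv_nonneg.mpr hη.le))
    have hs0 : 0 ≤ s := (norm_nonneg _).trans (hs x)
    calc wt L η j * ‖covDerivFwd η U₀ κ f x‖ ≤ (L * η) * (η⁻¹ * (2 * s)) :=
          mul_le_mul (hwt j hj) h1 (norm_nonneg _) (by positivity)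
      _ = 2 * L * s := by field_simp
  have hlap : ∀ (f : Site d → 𝔸) (s : ℝ), (∀ y, ‖f y‖ ≤ s) → ∀ x : Site d, wt L η 0 ^ 2 * ‖covLap η U₀ f x‖ ≤ 4 * d * s := by
    intro f s hs x
    have h := norm_covLap_le hη hU1 hs x
    have hs0 : 0 ≤ s := (norm_nonneg _).trans (hs x)
    simp only [wt, pow_zero, one_mul]
    calc η ^ 2 * ‖covLap η U₀ f x‖ ≤ η ^ 2 * (4 * d * (η⁻¹ * (η⁻¹ * s))) := mul_le_mul_of_nonneg_left h hη2.le
      _ = 4 * d * s := by field_simp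
  have hBd : ∀ (f : Site d → 𝔸) (r : ℝ), Bd2 L η 1 Ω f r → ∀ y, ‖f y‖ ≤ (η ^ 2)⁻¹ * r := by
    intro f r hf y
    have h := hf 0 (Nat.zero_le 1) y (by rw [hΩ0]; exact Set.mem_univ y)
    simp only [wt, pow_zero, one_mul] at h
    rw [inv_mul_eq_div, le_div_iff₀ hη2]; linarith
  refine ⟨LinearMap.id, Δ, q, qs, Aw, LinearMap.id, H', ?_, ?_, ?_, ?_, ?_, ?_, ?_, ?_, ?_, ?_, ?_, ?_⟩
  · -- (1) bounded left inverse: `Δx + qs Aw q x = x` identically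
    intro x _
    funext y
    simp only [LinearMap.id_apply, Aw, LinearMap.comp_apply, hqsq, LinearMap.sub_apply, LinearMap.id_apply, Pi.add_apply, Pi.sub_apply]
    abel
  · -- (2) `qs c q g g qs = qs`
    intro φ
    simp only [LinearMap.id_apply, hqsq]
  · intro f x _
    rw [hΔ, hΩ0, Set.indicator_univ]
  · intro μ x _
    have h0 : QprimeT L U₀ 1 ((Λs 1 1).indicator (μ 1)) x = 0 := by
      rw [hΛ1, Set.indicator_empty]; exact QprimeT_zero L U₀ 1 x
    rw [hqs, QT, Finset.sum_range_succ, Finset.sum_range_succ, Finset.sum_range_zero, zero_add, h0, add_zero, hΛ0, Set.indicator_univ]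
    rfl
  · intro f j hj y hy
    rcases Nat.le_one_iff_eq_zero_or_eq_one.1 hj with rfl | rfl
    · rw [hq0]; rfl
    · rw [hΛ1] at hy; exact absurd hy (Set.notMem_empty y)
  · -- `q = 0` off the tower: level `0` is all of `ℤᵈ`, higher levels carry nothing
    intro f n y hny
    rcases Nat.eq_zero_or_pos n with rfl | hn
    · rw [hΛ0] at hny; exact absurd ⟨Nat.zero_le 1, Set.mem_univ y⟩ hny
    · rw [hqne f n (by omega)]; rfl
  · intro X x
    exact (hHn X x).trans (le_mul_of_one_le_left (norm_nonneg X) (by linarith))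
  · intro j hj X p _
    exact hder (H' X) ‖X‖ (hHn X) j hj p.1 p.2
  · intro X j hj x hx
    rcases Nat.le_one_iff_eq_zero_or_eq_one.1 hj with rfl | rfl
    · exact hlap (H' X) ‖X‖ (hHn X) x
    · rw [hΩ1] at hx; exact absurd hx (Set.notMem_empty x)
  · intro Y j hj y hy
    rcases Nat.le_one_iff_eq_zero_or_eq_one.1 hj with rfl | rfl
    · rfl
    · rw [hΛ1] at hy; exact absurd hy (Set.notMem_empty y)
  · intro f r hr hf
    have hb := hBd f r hf
    have hrη : (η ^ 2)⁻¹ * r ≤ 2 * L * (η ^ 2)⁻¹ * r := by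
      have : 0 ≤ (η ^ 2)⁻¹ * r := by positivity
      nlinarith
    refine ⟨fun x => (hb x).trans (by simpa using hrη), fun j hj p _ => ?_⟩
    calc wt L η j * ‖covDerivFwd η U₀ p.2 (LinearMap.id f) p.1‖ ≤ 2 * L * ((η ^ 2)⁻¹ * r) := hder f _ hb j hj p.1 p.2
      _ = 2 * L * (η ^ 2)⁻¹ * r := by ring
  · intro f r _ _ j _ x _
    simp only [LinearMap.id_apply, hqsq, sub_self, Pi.zero_apply, norm_zero, mul_zero, zero_mul, le_refl]

end Letters

/-! ## §3 On the index of record at `θ.D θ.L θ.𝔸` (`θ : Node00.Stage3Params`) -/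

section Stage3

/-- ★★ **`SLet`'S BODY IS INHABITED AT A MEMBER OF THE P₂D INDEX**: there is `j : IdxB8SubD θ` (the empty tower, `k = 1`, `η = L⁻¹`) at which `SockLettersRD θ.L BG BR B₀′H B₂′ cP j.η j.k j.Ω j.Λs`
holds with `BG = 2L³`, `BR = 0`, `B₀′H = 2L`, `B₂′ = 4D`, every `cP` — WATCH-P2D-SLET-INHABITATION in its weak (one-member) form.  Degenerate witness (§2); nothing of [4] Thm 3.1; the
binder over ALL members stays N06 content. [cite: Balaban1985RegularSpaces, (1.3)–(1.6) p.77, (1.91)–(1.92) p.91, (1.101) p.93; Balaban1985BackgroundPropagators, Thm 3.1 p.397] -/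
theorem exists_idxB8SubD_sockLettersRD (θ : Stage3Params) (cP : ℝ) :
    ∃ j : IdxB8SubD θ, j.1.1.1.1.k = 1 ∧
      SockLettersRD (𝔸 := θ.𝔸) θ.L (2 * (θ.L : ℝ) ^ 3) 0 (2 * θ.L) (4 * θ.D) cP j.1.1.1.1.η j.1.1.1.1.k j.1.1.1.1.Ω j.1.1.1.1.Λs := by
  have hL : 1 ≤ θ.L := le_trans (by norm_num) θ.two_le_L
  have hL0 : (0 : ℝ) < θ.L := by exact_mod_cast (show 0 < θ.L by omega)
  obtain ⟨j, hk, hη, hΩ, hΛ0, hΛ1⟩ := exists_idxB8SubD_emptyTower θ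
  refine ⟨j, hk, ?_⟩
  have hΩ0 : j.1.1.1.1.Ω 0 = Set.univ := by rw [hΩ]; exact if_pos rfl
  have hΩ1 : j.1.1.1.1.Ω 1 = ∅ := by rw [hΩ]; exact if_neg one_ne_zero
  have hBG : 2 * (θ.L : ℝ) ^ 3 = 2 * θ.L * (j.1.1.1.1.η ^ 2)⁻¹ := by rw [hη, inv_pow, inv_inv]; ring
  rw [hk, hBG]
  exact sockLettersRD_emptyTower hL (by rw [hη]; exact inv_pos.mpr hL0) hΩ0 hΩ1 hΛ0 hΛ1 cP

/-- ★ **`SLetUB`'S INLINE BODY IS INHABITED AT THE SAME MEMBER** (same constants). [cite: Balaban1985RegularSpaces, (1.107)–(1.109) p.94; Balaban1985BackgroundPropagators, Thm 3.1 p.397] -/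
theorem exists_idxB8SubD_sLetUB_text (θ : Stage3Params) (cL : ℝ) :
    ∃ j : IdxB8SubD θ, j.1.1.1.1.k = 1 ∧
      ∀ α₀ : ℝ, 0 < α₀ → α₀ ≤ cL → ∀ U₀ : Site θ.D → Fin θ.D → θ.𝔸ˣ, (∀ x κ, U₀ x κ ∈ unitaryUnits θ.𝔸) → InAk θ.L 1 j.1.1.1.1.η α₀ j.1.1.1.1.Ω U₀ →
      ∃ (g Δ : (Site θ.D → θ.𝔸) →ₗ[ℂ] (Site θ.D → θ.𝔸)) (q : (Site θ.D → θ.𝔸) →ₗ[ℂ] (ℕ → Site θ.D → θ.𝔸))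
        (qs : (ℕ → Site θ.D → θ.𝔸) →ₗ[ℂ] (Site θ.D → θ.𝔸)) (Aw c : (ℕ → Site θ.D → θ.𝔸) →ₗ[ℂ] (ℕ → Site θ.D → θ.𝔸))
        (H' : XSpace θ.D 1 θ.𝔸 →ₗ[ℂ] (Site θ.D → θ.𝔸)),
        (∀ x : Site θ.D → θ.𝔸, (∃ C : ℝ, ∀ y, ‖x y‖ ≤ C) → g (Δ x + qs (Aw (q x))) = x) ∧ (∀ φ, qs (c (q (g (g (qs φ))))) = qs φ) ∧
        (∀ (f : Site θ.D → θ.𝔸), ∀ x ∈ j.1.1.1.1.Ω 0, Δ f x = covLap j.1.1.1.1.η U₀ ((j.1.1.1.1.Ω 0).indicator f) x) ∧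
        (∀ (μ : ℕ → Site θ.D → θ.𝔸), ∀ x ∈ j.1.1.1.1.Ω 0, qs μ x = QT θ.L 1 (j.1.1.1.1.Λs 1) U₀ μ x) ∧
        (∀ (f : Site θ.D → θ.𝔸) (n : ℕ), n ≤ 1 → ∀ y ∈ j.1.1.1.1.Λs 1 n, q f n y = QprimeIter (zdBlocking θ.D θ.L) (bgT θ.L U₀) n f y) ∧
        (∀ (f : Site θ.D → θ.𝔸) (n : ℕ) (y : Site θ.D), ¬ (n ≤ 1 ∧ y ∈ j.1.1.1.1.Λs 1 n) → q f n y = 0) ∧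
        (∀ (X : XSpace θ.D 1 θ.𝔸) (x : Site θ.D), ‖H' X x‖ ≤ (2 * θ.L) * ‖X‖) ∧
        (∀ n, n ≤ 1 → ∀ (X : XSpace θ.D 1 θ.𝔸), ∀ p ∈ {b : Site θ.D × Fin θ.D | SideTouches (j.1.1.1.1.Ω n) b.1 b.2},
          wt θ.L j.1.1.1.1.η n * ‖covDerivFwd j.1.1.1.1.η U₀ p.2 (H' X) p.1‖ ≤ (2 * θ.L) * ‖X‖) ∧
        (∀ X : XSpace θ.D 1 θ.𝔸, Bd2 θ.L j.1.1.1.1.η 1 j.1.1.1.1.Ω (covLap j.1.1.1.1.η U₀ (H' X)) ((4 * θ.D) * ‖X‖)) ∧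
        (∀ (Y : XSpace θ.D 1 θ.𝔸) (n : ℕ) (hn : n ≤ 1) (y : Site θ.D), y ∈ j.1.1.1.1.Λs 1 n →
          QprimeIter (zdBlocking θ.D θ.L) (bgT θ.L U₀) n (H' Y) y = Y (⟨n, Nat.lt_succ_of_le hn⟩, y)) ∧
        (∀ (f : Site θ.D → θ.𝔸) (r : ℝ), 0 ≤ r → Bd2 θ.L j.1.1.1.1.η 1 j.1.1.1.1.Ω f r →
          (∀ x, ‖g f x‖ ≤ (2 * (θ.L : ℝ) ^ 3) * r) ∧ ∀ n, n ≤ 1 → ∀ p ∈ {b : Site θ.D × Fin θ.D | SideTouches (j.1.1.1.1.Ω n) b.1 b.2},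
            wt θ.L j.1.1.1.1.η n * ‖covDerivFwd j.1.1.1.1.η U₀ p.2 (g f) p.1‖ ≤ (2 * (θ.L : ℝ) ^ 3) * r) ∧
        (∀ (f : Site θ.D → θ.𝔸) (r : ℝ), 0 ≤ r → Bd2 θ.L j.1.1.1.1.η 1 j.1.1.1.1.Ω f r → Bd2 θ.L j.1.1.1.1.η 1 j.1.1.1.1.Ω (f - g (qs (c (q (g f))))) (0 * r)) := by
  have hL : 1 ≤ θ.L := le_trans (by norm_num) θ.two_le_L
  have hL0 : (0 : ℝ) < θ.L := by exact_mod_cast (show 0 < θ.L by omega)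
  obtain ⟨j, hk, hη, hΩ, hΛ0, hΛ1⟩ := exists_idxB8SubD_emptyTower θ
  refine ⟨j, hk, ?_⟩
  have hΩ0 : j.1.1.1.1.Ω 0 = Set.univ := by rw [hΩ]; exact if_pos rfl
  have hΩ1 : j.1.1.1.1.Ω 1 = ∅ := by rw [hΩ]; exact if_neg one_ne_zero
  have hBG : 2 * (θ.L : ℝ) ^ 3 = 2 * θ.L * (j.1.1.1.1.η ^ 2)⁻¹ := by rw [hη, inv_pow, inv_inv]; ring
  rw [hBG]
  exact sLetUB_text_emptyTower hL (by rw [hη]; exact inv_pos.mpr hL0) hΩ0 hΩ1 hΛ0 hΛ1 cL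

end Stage3

end Literature.MathematicalPhysics.QuantumFieldTheory.Balaban1983to89.B8SockLettersRDEmptyTowerInhabited

end
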